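import Mathlib.GroupTheory.SpecificGroups.Quaternion
import Summits.MatrixMultiplication.OmegaCensus.DicyclicLawQuotientCyclic
import HarnessLib

/-!
# `C₂ × Q_{4m}` (`m ≡ 4 (mod 6)`) never attains the mod-one law

ω-census, family (b3).  Framing: lottery ticket; floor = certified bounds/negative ranges.

The Mathlib group `Multiplicative (ZMod 2) × QuaternionGroup m` is the dihedral-like group `G(ℤ₂ × ℤ_{2m}, (0, m))`
(`ρ(i,b) = (i, a b)`, `τ(i,b) = (i, xa b)`), i.e. `C₂ × Q_{4m}`, `|A| = 4m`.  For `m ≡ 4 (mod 6)` (`|A| ≡ 1 (mod 3)`, `m` even,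
so `c₀ = (0,m) = 2·(0,m/2) ∈ 2A` while `A` is not cyclic) `no_mod_one_law_Z2_Zn_half` (`DicyclicLawQuotientCyclic.lean`) says:
**no TPP triple of `C₂ × Q_{4m}` attains `3|S||T||U| + 8 = 8|A| = 32m`** (`no_mod_one_law_c2_quaternion`; `m = 4, 10, 16, …`:
`C₂ × Q₁₆`, `C₂ × Q₄₀`, `C₂ × Q₆₄`, …), although `A = ℤ₂ × ℤ_{2m}` has the cyclic subgroup `ℤ_{2m}` of index `2` and the
sibling groups `C₂ × D_{4m}`, `ℤ_{2m} ⋊ ℤ₄` over the same `A` do attain (`c2_dihedral_law`, `z2zn_mod_one_law_attained`).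
With the law (`3V + 8 ≤ 32m`) and the mod-one gap (`DihedralLikeLawGap`): `β(C₂ × Q_{4m}) ≤ (32m − 14)/3`.
-/

namespace Summit.MatrixMultiplication.OmegaCensus

open Literature.Combinatorics.Additive Finset

/-- **`C₂ × Q_{4m}`, `m ≡ 4 (mod 6)`: no TPP triple attains `3|S||T||U| + 8 = 32m`.** [folklore] -/
theorem no_mod_one_law_c2_quaternion {m : ℕ} [NeZero m] (hm2 : 2 ∣ m) (hm3 : m % 3 = 1)
    {S T U : Finset (Multiplicative (ZMod 2) × QuaternionGroup m)} (h : TripleProductProperty S T U) :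
    3 * (S.card * T.card * U.card) + 8 ≠ 32 * m := by
  haveI : NeZero (2 * m) := ⟨by have := NeZero.ne m; omega⟩
  have hdiv : ((2 * m / 2 : ℕ) : ZMod (2 * m)) = (m : ZMod (2 * m)) := by
    rw [Nat.mul_div_cancel_left m (by norm_num)]
  have key := no_mod_one_law_Z2_Zn_half (n := 2 * m)
    (G := Multiplicative (ZMod 2) × QuaternionGroup m)
    (ρ := fun p : ZMod 2 × ZMod (2 * m) => (Multiplicative.ofAdd p.1, QuaternionGroup.a p.2))
    (τ := fun p : ZMod 2 × ZMod (2 * m) => (Multiplicative.ofAdd p.1, QuaternionGroup.xa p.2))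
    (S := S) (T := T) (U := U)
    (Nat.mul_dvd_mul_left 2 hm2 |> fun h4 => by simpa [Nat.mul_comm] using h4) (by omega)
    (fun a b => by
      simp only [Prod.mk_mul_mk, QuaternionGroup.a_mul_a, ← ofAdd_add, Prod.fst_add, Prod.snd_add])
    (fun a b => by
      simp only [Prod.mk_mul_mk, QuaternionGroup.a_mul_xa, ← ofAdd_add, Prod.fst_sub, Prod.snd_sub]
      rw [sub_eq_add_neg b.1, ZMod.neg_eq_self_mod_two, add_comm b.1])
    (fun a b => by
      simp only [Prod.mk_mul_mk, QuaternionGroup.xa_mul_a, ← ofAdd_add, Prod.fst_add, Prod.snd_add])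
    (fun a b => by
      simp only [Prod.mk_mul_mk, QuaternionGroup.xa_mul_xa, ← ofAdd_add, Prod.fst_sub, Prod.snd_sub, Prod.fst_add,
        Prod.snd_add, hdiv, zero_add]
      rw [sub_eq_add_neg b.1, ZMod.neg_eq_self_mod_two, add_comm b.1])
    (fun a b hab => by
      simp only [Prod.mk.injEq, QuaternionGroup.a.injEq] at hab
      exact Prod.ext (Multiplicative.ofAdd.injective hab.1) hab.2)
    (fun a b hab => by
      simp only [Prod.mk.injEq, QuaternionGroup.xa.injEq] at hab
      exact Prod.ext (Multiplicative.ofAdd.injective hab.1) hab.2)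
    (fun a b hab => by simp at hab)
    (fun g => by
      obtain ⟨i, q⟩ := g
      cases q with
      | a j => exact Or.inl ⟨(Multiplicative.toAdd i, j), rfl⟩
      | xa j => exact Or.inr ⟨(Multiplicative.toAdd i, j), rfl⟩)
    h
  omega

end Summit.MatrixMultiplication.OmegaCensus
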